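/-
COR-CM (cell pub-hodgecm2, stage 2 of the Hodge ladder) — TRANSPOSITION item (vi), sub-binder (vi-1)/(vi-0) GLUE (ITEM6-SPLIT.md
§(c′); suggestion of htheta-x1, hodge-director/INBOX l.433/l.439, generalised).  Seat prover-pub-hodgecm2-item6-p3-0 (item (vi) extra
prover 3/4; path named in HOME/INBOX before filing, rule (1)).  Theorems only: no definition, no named fact, nothing cited as a record,
nothing asserted; `Transposition/Assembly.lean` (p271429) and `Transposition/Item6SupplyAssembly.lean` (p272758) are imported BY NAME and
not refiled.  FRAMING (COORDINATOR RULING 2026-08-21T11:55:35Z): HC_CM is NOT proved; no declaration below inhabits any displayed hypothesis.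
-/
import Summits.HodgeConjecture.CorCM.B01.Transposition.Assembly
import Summits.HodgeConjecture.CorCM.B01.Transposition.Item6SupplyAssembly
import HarnessLib

/-!
# Transposition item (vi): the ADMISSIBILITY-FREE, PIN-FREE forms of the witness / socket interfaces, and `HC_CM` from them

The day-1 assembly `Universe.FaceThetaDataExists` (`Transposition/Assembly.lean:52`) and the witness form of
`CorCM/FacePeriodWitnesses.lean:74` both ask the item-(vi) supplier for an ADMISSIBLE surface embedding `ι₁` (`f.Admissible ι₁`)
and put the hermitian space over that `ι₁`; the socket moreover pins the eigen-embedding of the one-forms to `σ = ι₁`.  The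
package-side supplier of item (vi) (stage-1 face heads #H18–#H20) naturally produces theta data on the surfaces `P_Γ(V)` at the
REPRESENTATIVE embedding `(InfinitePlace.mk σ).embedding` of an admissible `σ`, with `σ`-eigen one-forms (htheta-x1,
hodge-director/INBOX l.439) — which is admissible for the eigen-embedding, not necessarily for the surface embedding, and would
otherwise cost a `transposeAt` re-presentation of the hermitian space (x1 l.433: ≈ 100 lines, package side).

None of this is needed for `HC_CM`.  The surface criterion rfwf Prop. 2.2 (`Universe.SurfaceCriterion`,
`Geometry/Statements.lean:95`) takes ANY surface of dimension two and asks admissibility only of the EIGEN-embedding; a period witness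
at any eigen-embedding `σ` transports to every embedding lying in all four types (`CorCM/PeriodCharacterTransport.lean`,
`Universe.periodNV_of_periodNV_of_forall_mem`), in particular to an admissible one, which exists for `[F:ℚ] ≥ 6`
(`StubTree.admissible_exists`, `admissible_mem_psi`).  Hence the FREE witness form

  `∀ F` Galois CM, `6 ≤ [F:ℚ]`, `∀ f : Face F`, `∃ (ι₁ : F →+* ℂ) (V : HermSpace3 F ι₁) (σ : F →+* ℂ), U.PeriodNV ι₁ V F f.psi σ`

(no `f.Admissible`, `σ` and `ι₁` unrelated) already gives `W_RK4`, and on the universe of record `HC_CM`; and so does the FREE socket form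
`∃ ι₁ V σ, Nonempty (U.FaceThetaDatum ι₁ V F f.psi σ)` (the engine `Universe.periodNV_of_faceThetaDatum` is `σ`-generic) and the FREE
form of the items' conjunction of `Transposition.exists_faceThetaDatum_of_items`.

* `Universe.w_rk4_of_exists_periodNV_free` — free witnesses ⟹ `W_RK4` (facts `Fact_eigenLine`, `Fact_alphaLine`, `SurfaceCriterion`,
  `PmsDimTwo`, as in `w_rk4_of_exists_periodNV`);  comparisons `exists_periodNV_free_of_exists_periodNV` (the l.74 form ⟹ free) and
  `exists_periodNV_free_of_periodThmF`.
* `Assembly.hc_cm_of_exists_periodNV_free`, `Model.hc_cm_of_rows_of_exists_periodNV_free`, `Model.chainR_of_exists_periodNV_free`,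
  `hc_cm_of_exists_facePeriod_free`, `hc_cm_closed_of_exists_facePeriod_free` — the chain of `FacePeriodWitnesses.lean` on the free form.
* `Universe.exists_periodNV_free_of_exists_faceThetaDatum`, `Universe.exists_faceThetaDatum_free_of_faceThetaDataExists`,
  `Model.hc_cm_closed_of_exists_faceThetaDatum_free` — the socket: face theta data at ANY `(ι₁, V, σ)` per field-and-face ⟹ `HC_CM`
  (ONE binder; `FaceThetaDataExists U_rec` implies its hypothesis by `exists_faceThetaDatum_free_of_faceThetaDataExists`, so the day-1
  target `hc_cm_closed_of_faceThetaDataExists` factors through it).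
* `Transposition.exists_faceThetaDatum_free_of_items`, `Model.hc_cm_closed_of_items_free` — the items delivered jointly at any
  `(ι₁, V, σ)` give the free socket form, hence `HC_CM` on the universe of record.

READING for the item-(vi) lineage: the supplier may deliver its `FaceThetaSupply` / `FaceThetaDatum` at whatever surface embedding and
eigen-embedding its construction produces; admissibility and the pin `σ = ι₁` are idle for `HC_CM` (as `∀ V` was shown idle in
`FacePeriodWitnesses.lean`).  Nothing displayed changes; the wording of record is untouched.
-/

noncomputable section

open scoped TensorProduct InnerProductSpace

namespace Summit.HodgeConjecture.CorCM

open Literature.AlgebraicGeometry.Motives (CMType HodgeStructure)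
open Literature.AlgebraicGeometry.Motives.HodgeStructure (conj)
open Literature.AlgebraicGeometry.HodgeTheory
open Literature.NumberTheory.Automorphic
open Literature.NumberTheory.Automorphic.PicardCM

namespace Universe

variable {U : Universe}

/-- **Free face-period witnesses give `W^{RK4}`.**  On a universe with one-dimensional CM eigenlines (`Fact_eigenLine`), the CM-type
condition (`Fact_alphaLine`), the surface criterion rfwf Prop. 2.2 and `dim P_Γ = 2`: if every face of every Galois CM field of degree
`≥ 6` has a non-zero period on SOME compact Picard modular surface `P_Γ(V)` — `V` over ANY embedding `ι₁`, eigenforms at ANY embedding `σ`,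
no admissibility asked — then every rank-four Weil line is algebraic.  (Pick an admissible `τ` by `StubTree.admissible_exists`; transport
`σ ↦ τ` by `periodNV_of_periodNV_of_forall_mem`, `τ ∈ ⋂ᵢ ψᵢ` by `admissible_mem_psi`; apply the surface criterion to `S = P_Γ(V)`.)
[folklore] -/
theorem w_rk4_of_exists_periodNV_free (hE : U.Fact_eigenLine) (hA : U.Fact_alphaLine) (h22 : U.SurfaceCriterion)
    (hdim : U.PmsDimTwo)
    (h : ∀ (F : CMField), IsGalois ℚ F → 6 ≤ Module.finrank ℚ F → ∀ f : Face F,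
      ∃ (ι₁ : F →+* ℂ) (V : HermSpace3 F ι₁) (σ : F →+* ℂ), U.PeriodNV ι₁ V F f.psi σ) :
    U.W_RK4 := by
  intro F hG h6 f
  obtain ⟨ι₁, V, σ, hσ⟩ := h F hG h6 f
  obtain ⟨τ, hτ⟩ := StubTree.admissible_exists F h6 f
  obtain ⟨Γ, Fm, α, hα, hper⟩ := periodNV_of_periodNV_of_forall_mem hE hA (admissible_mem_psi f τ hτ) hσ
  exact h22 F hG f τ hτ (U.pms F ι₁ V Γ) (hdim F ι₁ V Γ) Fm α hα hper

/-- The witness form of `FacePeriodWitnesses.lean:74` (admissible surface embedding, free eigen-embedding) implies the free form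
(forget admissibility). [folklore] -/
theorem exists_periodNV_free_of_exists_periodNV
    (h : ∀ (F : CMField), IsGalois ℚ F → 6 ≤ Module.finrank ℚ F → ∀ f : Face F,
      ∃ ι₁ : F →+* ℂ, f.Admissible ι₁ ∧ ∃ (V : HermSpace3 F ι₁) (σ : F →+* ℂ), U.PeriodNV ι₁ V F f.psi σ) :
    ∀ (F : CMField), IsGalois ℚ F → 6 ≤ Module.finrank ℚ F → ∀ f : Face F,
      ∃ (ι₁ : F →+* ℂ) (V : HermSpace3 F ι₁) (σ : F →+* ℂ), U.PeriodNV ι₁ V F f.psi σ := by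
  intro F hG h6 f
  obtain ⟨ι₁, -, V, σ, hσ⟩ := h F hG h6 f
  exact ⟨ι₁, V, σ, hσ⟩

/-- `PeriodThmF` implies the free witness form (one admissible `ι₁` by `StubTree.admissible_exists`, one hermitian space by Landherr,
`σ = ι₁`). [folklore] -/
theorem exists_periodNV_free_of_periodThmF (h : U.PeriodThmF) :
    ∀ (F : CMField), IsGalois ℚ F → 6 ≤ Module.finrank ℚ F → ∀ f : Face F,
      ∃ (ι₁ : F →+* ℂ) (V : HermSpace3 F ι₁) (σ : F →+* ℂ), U.PeriodNV ι₁ V F f.psi σ :=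
  exists_periodNV_free_of_exists_periodNV (facePeriodWitness_of_periodThmF h)

/-- **Free face theta data give free period witnesses** (the engine `periodNV_of_faceThetaDatum` run per face; it is generic in the
eigen-embedding `σ` and in the surface embedding `ι₁`). [folklore] -/
theorem exists_periodNV_free_of_exists_faceThetaDatum (hc : U.Fact_pull_comp) (hH : U.Fact_pull_hodge)
    (hcup2 : U.Fact_cup2_hodge) (hpc : U.Fact_pull_cup)
    (h : ∀ (F : CMField), IsGalois ℚ F → 6 ≤ Module.finrank ℚ F → ∀ f : Face F,
      ∃ (ι₁ : F →+* ℂ) (V : HermSpace3 F ι₁) (σ : F →+* ℂ), Nonempty (U.FaceThetaDatum ι₁ V F f.psi σ)) :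
    ∀ (F : CMField), IsGalois ℚ F → 6 ≤ Module.finrank ℚ F → ∀ f : Face F,
      ∃ (ι₁ : F →+* ℂ) (V : HermSpace3 F ι₁) (σ : F →+* ℂ), U.PeriodNV ι₁ V F f.psi σ := by
  intro F hG h6 f
  obtain ⟨ι₁, V, σ, ⟨R⟩⟩ := h F hG h6 f
  exact ⟨ι₁, V, σ, periodNV_of_faceThetaDatum hc hH hcup2 hpc R⟩

/-- `FaceThetaDataExists U` (admissible `ι₁`, pin `σ = ι₁`; `Transposition/Assembly.lean:52`) implies the free socket form. [folklore] -/
theorem exists_faceThetaDatum_free_of_faceThetaDataExists (h : U.FaceThetaDataExists) :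
    ∀ (F : CMField), IsGalois ℚ F → 6 ≤ Module.finrank ℚ F → ∀ f : Face F,
      ∃ (ι₁ : F →+* ℂ) (V : HermSpace3 F ι₁) (σ : F →+* ℂ), Nonempty (U.FaceThetaDatum ι₁ V F f.psi σ) := by
  intro F hG h6 f
  obtain ⟨ι₁, -, V, hR⟩ := h F hG h6 f
  exact ⟨ι₁, V, ι₁, hR⟩

end Universe

namespace Assembly

open Universe StubTree

variable (U : Universe)

/-- **COR-CM from free face-period witnesses** — `Assembly.hc_cm_of_exists_periodNV` with the free witness hypothesis: for a universe
satisfying the model facts `ModelAxioms` and the textbook facts N1–N4, F2, F4–F7, one non-zero face period per face (any surface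
embedding, any hermitian space, any level, any eigen-embedding) implies `HC_CM`: witnesses ⟹ `W^{RK4}` ⟹ (Pohlmann + [QW8] Thm 2.5)
`FaceReduction` ⟹ (rfwf Lemma 8.2) `HC_CM`. [folklore] -/
theorem hc_cm_of_exists_periodNV_free (M : U.ModelAxioms)
    (h : ∀ (F : CMField), IsGalois ℚ F → 6 ≤ Module.finrank ℚ F → ∀ f : Face F,
      ∃ (ι₁ : F →+* ℂ) (V : HermSpace3 F ι₁) (σ : F →+* ℂ), U.PeriodNV ι₁ V F f.psi σ)
    (hN1 : U.Fact_cupExterior) (hN2 : U.Fact_cup_hodge) (hN3 : U.Fact_pull_H0) (hN4 : U.Fact_hodge_F0)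
    (h2 : U.Fact_factorActDescends) (h4 : U.Fact_cupAlg) (h5 : U.Fact_cupAssoc) (h6 : U.Fact_weightDual)
    (h7 : U.Fact_gysin) : U.HC_CM :=
  hc_cm_of U
    (Universe.w_rk4_of_exists_periodNV_free M.eigenLine M.alphaLine (Universe.surfaceCriterion_holds M) M.pms_dim h)
    (faceReduction_holds U (U.pohlmannSpan_of_facts M hN1 hN2 hN3 hN4)
      (U.qw8Sufficiency_of_geometricFacts M hN1 hN2 hN3 hN4 h2 h4 h5 h6 h7))
    (lemma81_holds U M)

end Assembly

namespace Model

/-- **The model chain from free witnesses, rows M22 and F7 as hypotheses** (the pattern of `Model.hc_cm_of_rows_of_exists_periodNV`).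
[folklore] -/
theorem hc_cm_of_rows_of_exists_periodNV_free (hHD : exists_isReal_hodgeModel) (hI : hodgePQ_independent_of_hodgeModel)
    (hU : BallQuotientUniformisedDatum) (h₃ : CMAbelianVarietyRealised) (hR : DeligneMilne1982_Thm_6_20_full)
    (h28 : (universeOf hHD hI hU h₃).Fact_algDuality) (hF7 : (universeOf hHD hI hU h₃).Fact_gysin)
    (h : ∀ (F : CMField), IsGalois ℚ F → 6 ≤ Module.finrank ℚ F → ∀ f : Face F,
      ∃ (ι₁ : F →+* ℂ) (V : HermSpace3 F ι₁) (σ : F →+* ℂ), (universeOf hHD hI hU h₃).PeriodNV ι₁ V F f.psi σ) :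
    (universeOf hHD hI hU h₃).HC_CM :=
  Assembly.hc_cm_of_exists_periodNV_free (universeOf hHD hI hU h₃) (modelAxioms_of_rows hHD hI hU h₃ hR h28) h
    (universeOf_fact_cupExterior hHD hI hU h₃) (universeOf_fact_cup_hodge hHD hI hU h₃)
    (universeOf_fact_pull_H0 hHD hI hU h₃) (universeOf_fact_hodge_F0 hHD hI hU h₃)
    (universeOf_fact_factorActDescends hHD hI hU h₃ (modelAxioms_of_rows hHD hI hU h₃ hR h28))
    (universeOf_fact_cupAlg hHD hI hU h₃) (universeOf_fact_cupAssoc hHD hI hU h₃)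
    (universeOf_fact_weightDual hHD hI hU h₃ (modelAxioms_of_rows hHD hI hU h₃ hR h28)) hF7

/-- **The model chain from free witnesses, CLOSED rows** (M22 = `universeOf_algDuality`, F7 = `universeOf_fact_gysin`; the pattern of
`Model.chainR_of_exists_periodNV`). [folklore] -/
theorem chainR_of_exists_periodNV_free (hHD : exists_isReal_hodgeModel) (hI : hodgePQ_independent_of_hodgeModel)
    (h₁ : BallQuotientUniformised) (h₃ : CMAbelianVarietyRealised) (hR : DeligneMilne1982_Thm_6_20_full)
    (h : ∀ (F : CMField), IsGalois ℚ F → 6 ≤ Module.finrank ℚ F → ∀ f : Face F,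
      ∃ (ι₁ : F →+* ℂ) (V : HermSpace3 F ι₁) (σ : F →+* ℂ), (picardCMUniverse hHD hI h₁ h₃).PeriodNV ι₁ V F f.psi σ) :
    (picardCMUniverse hHD hI h₁ h₃).HC_CM :=
  hc_cm_of_rows_of_exists_periodNV_free hHD hI (ballQuotientUniformisedDatum_of h₁) h₃ hR
    (universeOf_algDuality hHD hI _ h₃) (universeOf_fact_gysin hHD hI _ h₃) h

end Model

/-- **`HC_CM` from free face-period witnesses on the universe of record** (the pattern of `hc_cm_of_exists_facePeriod`): for every
instance `hHD hI h₁ h₃` of the Picard–CM model universe, one non-zero face period per face of every Galois CM field of degree `≥ 6` — on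
some compact Picard modular surface over any embedding, with eigenforms at any embedding — together with Deligne–Milne 1982 Thm 6.20
implies `HC_CM` BY NAME. [folklore] -/
theorem hc_cm_of_exists_facePeriod_free (hHD : exists_isReal_hodgeModel) (hI : hodgePQ_independent_of_hodgeModel)
    (h₁ : BallQuotientUniformised) (h₃ : CMAbelianVarietyRealised)
    (h : ∀ (F : CMField), IsGalois ℚ F → 6 ≤ Module.finrank ℚ F → ∀ f : Face F,
      ∃ (ι₁ : F →+* ℂ) (V : HermSpace3 F ι₁) (σ : F →+* ℂ), (Model.picardCMUniverse hHD hI h₁ h₃).PeriodNV ι₁ V F f.psi σ)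
    (hR : DeligneMilne1982_Thm_6_20_full) : HC_CM :=
  hc_cm_of_model_hc_cm_riemann hHD hI h₁ h₃ hR (Model.chainR_of_exists_periodNV_free hHD hI h₁ h₃ hR h)

/-- **`HC_CM` from free face-period witnesses alone** (the five data instantiated by the tree theorems, the pattern of
`hc_cm_closed_of_exists_facePeriod`).  `HC_CM` is NOT proved: nobody has produced the witnesses. [folklore] -/
theorem hc_cm_closed_of_exists_facePeriod_free
    (h : ∀ (F : CMField), IsGalois ℚ F → 6 ≤ Module.finrank ℚ F → ∀ f : Face F,
      ∃ (ι₁ : F →+* ℂ) (V : HermSpace3 F ι₁) (σ : F →+* ℂ),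
        (Model.picardCMUniverse exists_isReal_hodgeModel_holds hodgePQ_independent_of_hodgeModel_holds
          BallQuotient.ballQuotientUniformised_holds cmAbelianVarietyRealised_holds).PeriodNV ι₁ V F f.psi σ) : HC_CM :=
  hc_cm_of_exists_facePeriod_free _ _ _ _ h deligneMilne1982_Thm_6_20_full_holds

namespace Model

/-- **`HC_CM` from FREE face theta data on the universe of record, BY NAME** — ONE binder, weaker than `FaceThetaDataExists U_rec` of
`Transposition/Assembly.lean:85`: for every Galois CM field `F` with `6 ≤ [F:ℚ]` and every face `f`, face-scoped theta-realisation data on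
the tower of SOME hermitian 3-space over SOME embedding `ι₁`, with one-forms of types `f.psi` at SOME eigen-embedding `σ` (no
admissibility, no pin).  `HC_CM` is NOT proved: nobody has inhabited the hypothesis. [folklore] -/
theorem hc_cm_closed_of_exists_faceThetaDatum_free
    (h : ∀ (F : CMField), IsGalois ℚ F → 6 ≤ Module.finrank ℚ F → ∀ f : Face F,
      ∃ (ι₁ : F →+* ℂ) (V : HermSpace3 F ι₁) (σ : F →+* ℂ),
        Nonempty ((picardCMUniverse exists_isReal_hodgeModel_holds hodgePQ_independent_of_hodgeModel_holds
          BallQuotient.ballQuotientUniformised_holds cmAbelianVarietyRealised_holds).FaceThetaDatum ι₁ V F f.psi σ)) : HC_CM :=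
  hc_cm_closed_of_exists_facePeriod_free
    (Universe.exists_periodNV_free_of_exists_faceThetaDatum
      (universeOf_fact_pull_comp _ _ (ballQuotientUniformisedDatum_of BallQuotient.ballQuotientUniformised_holds) _)
      (universeOf_fact_pull_hodge _ _ (ballQuotientUniformisedDatum_of BallQuotient.ballQuotientUniformised_holds) _)
      (universeOf_fact_cup2_hodge _ _ (ballQuotientUniformisedDatum_of BallQuotient.ballQuotientUniformised_holds) _)
      (universeOf_fact_pull_cup _ _ (ballQuotientUniformisedDatum_of BallQuotient.ballQuotientUniformised_holds) _) h)

#print axioms hc_cm_closed_of_exists_faceThetaDatum_free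

end Model

namespace Transposition

/-- **The free socket form from the items delivered jointly at ANY `(ι₁, V, σ)`** — `exists_faceThetaDatum_of_items`
(`Item6SupplyAssembly.lean:339`) without the admissibility clause and with a free eigen-embedding `σ` of the supplied theta sets:
item (vi)'s supply datum `S : FaceThetaSupply U ι₁ V F f.psi σ` with Prop 4.3, items (i)/(iii)'s `L²` dictionary, item (v)'s coupling for
the supplied theta sets, Hodge–Riemann (2,0) on the tower and the two Hodge-type facts give `∃ ι₁ V σ, Nonempty (U.FaceThetaDatum ι₁ V F f.psi σ)`.
[folklore] -/
theorem exists_faceThetaDatum_free_of_items {U : Universe} (hH : U.Fact_pull_hodge) (hcup2 : U.Fact_cup2_hodge)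
    (hHR : ∀ {L : CMField} {ι₁ : L →+* ℂ} {V : HermSpace3 L ι₁} (Γ : Level V) (η : U.CohC (U.pms L ι₁ V Γ) 2),
      η ∈ (U.hodge (U.pms L ι₁ V Γ) 2).F 2 → η ≠ 0 → U.trC (U.pms L ι₁ V Γ) 4 (U.cup2C (U.pms L ι₁ V Γ) 2 η (conj η)) ≠ 0)
    (h : ∀ (F : CMField), IsGalois ℚ F → 6 ≤ Module.finrank ℚ F → ∀ f : Face F,
      ∃ (ι₁ : F →+* ℂ) (V : HermSpace3 F ι₁) (σ : F →+* ℂ) (S : FaceThetaSupply U ι₁ V F f.psi σ)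
        (HG : Type) (_ : NormedAddCommGroup HG) (_ : InnerProductSpace ℂ HG)
        (emb : ∀ Γ : Level V, U.CohC (U.pms F ι₁ V Γ) 2 →ₗ[ℂ] HG)
        (cover : ∀ (Γ Γ' : Level V), Γ' ≤ Γ → U.Mor (U.pms F ι₁ V Γ') (U.pms F ι₁ V Γ)),
        S.Wedge ∧
        (∀ (Γ : Level V) (ω₁ ω₂ : U.CohC (U.pms F ι₁ V Γ) 1), ω₁ ∈ S.Theta 0 Γ → ω₂ ∈ S.Theta 1 Γ →
          emb Γ (U.cup2C (U.pms F ι₁ V Γ) 1 ω₁ ω₂) ∈ (Submodule.span ℂ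
            {x : HG | ∃ (Γ' : Level V), ∃ ω₃ ∈ S.Theta 2 Γ', ∃ ω₄ ∈ S.Theta 3 Γ',
              x = emb Γ' (U.cup2C (U.pms F ι₁ V Γ') 1 ω₃ ω₄)}).topologicalClosure) ∧
        (∀ (Γ Γ' : Level V) (hle : Γ' ≤ Γ) (x : U.CohC (U.pms F ι₁ V Γ) 2),
          emb Γ' (U.pullC (cover Γ Γ' hle) 2 x) = emb Γ x) ∧
        (∀ Γ : Level V, ∃ c : ℂ, c ≠ 0 ∧ ∀ x y : U.CohC (U.pms F ι₁ V Γ) 2,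
          x ∈ (U.hodge (U.pms F ι₁ V Γ) 2).F 2 → y ∈ (U.hodge (U.pms F ι₁ V Γ) 2).F 2 →
            ⟪emb Γ y, emb Γ x⟫_ℂ = c * U.trC (U.pms F ι₁ V Γ) 4 (U.cup2C (U.pms F ι₁ V Γ) 2 x (conj y)))) :
    ∀ (F : CMField), IsGalois ℚ F → 6 ≤ Module.finrank ℚ F → ∀ f : Face F,
      ∃ (ι₁ : F →+* ℂ) (V : HermSpace3 F ι₁) (σ : F →+* ℂ), Nonempty (U.FaceThetaDatum ι₁ V F f.psi σ) := by
  intro F hG h6 f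
  obtain ⟨ι₁, V, σ, S, HG, _, _, emb, cover, hw, hcoup, hcov, hinner⟩ := h F hG h6 f
  exact ⟨ι₁, V, σ, ⟨S.toFaceThetaDatum HG emb (S.lineField_of_wedge hH hcup2 emb hinner hHR hw) hcoup cover hcov hinner⟩⟩

/-- The admissible, pinned form of the items' conjunction (the hypothesis of `exists_faceThetaDatum_of_items`) implies the free form
of the socket (forget admissibility; `σ = ι₁`). [folklore] -/
theorem exists_faceThetaDatum_free_of_items_pinned {U : Universe} (hH : U.Fact_pull_hodge) (hcup2 : U.Fact_cup2_hodge)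
    (hHR : ∀ {L : CMField} {ι₁ : L →+* ℂ} {V : HermSpace3 L ι₁} (Γ : Level V) (η : U.CohC (U.pms L ι₁ V Γ) 2),
      η ∈ (U.hodge (U.pms L ι₁ V Γ) 2).F 2 → η ≠ 0 → U.trC (U.pms L ι₁ V Γ) 4 (U.cup2C (U.pms L ι₁ V Γ) 2 η (conj η)) ≠ 0)
    (h : ∀ (F : CMField), IsGalois ℚ F → 6 ≤ Module.finrank ℚ F → ∀ f : Face F,
      ∃ ι₁ : F →+* ℂ, f.Admissible ι₁ ∧ ∃ (V : HermSpace3 F ι₁) (S : FaceThetaSupply U ι₁ V F f.psi ι₁)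
        (HG : Type) (_ : NormedAddCommGroup HG) (_ : InnerProductSpace ℂ HG)
        (emb : ∀ Γ : Level V, U.CohC (U.pms F ι₁ V Γ) 2 →ₗ[ℂ] HG)
        (cover : ∀ (Γ Γ' : Level V), Γ' ≤ Γ → U.Mor (U.pms F ι₁ V Γ') (U.pms F ι₁ V Γ)),
        S.Wedge ∧
        (∀ (Γ : Level V) (ω₁ ω₂ : U.CohC (U.pms F ι₁ V Γ) 1), ω₁ ∈ S.Theta 0 Γ → ω₂ ∈ S.Theta 1 Γ →
          emb Γ (U.cup2C (U.pms F ι₁ V Γ) 1 ω₁ ω₂) ∈ (Submodule.span ℂ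
            {x : HG | ∃ (Γ' : Level V), ∃ ω₃ ∈ S.Theta 2 Γ', ∃ ω₄ ∈ S.Theta 3 Γ',
              x = emb Γ' (U.cup2C (U.pms F ι₁ V Γ') 1 ω₃ ω₄)}).topologicalClosure) ∧
        (∀ (Γ Γ' : Level V) (hle : Γ' ≤ Γ) (x : U.CohC (U.pms F ι₁ V Γ) 2),
          emb Γ' (U.pullC (cover Γ Γ' hle) 2 x) = emb Γ x) ∧
        (∀ Γ : Level V, ∃ c : ℂ, c ≠ 0 ∧ ∀ x y : U.CohC (U.pms F ι₁ V Γ) 2,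
          x ∈ (U.hodge (U.pms F ι₁ V Γ) 2).F 2 → y ∈ (U.hodge (U.pms F ι₁ V Γ) 2).F 2 →
            ⟪emb Γ y, emb Γ x⟫_ℂ = c * U.trC (U.pms F ι₁ V Γ) 4 (U.cup2C (U.pms F ι₁ V Γ) 2 x (conj y)))) :
    ∀ (F : CMField), IsGalois ℚ F → 6 ≤ Module.finrank ℚ F → ∀ f : Face F,
      ∃ (ι₁ : F →+* ℂ) (V : HermSpace3 F ι₁) (σ : F →+* ℂ), Nonempty (U.FaceThetaDatum ι₁ V F f.psi σ) := by
  intro F hG h6 f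
  obtain ⟨ι₁, -, V, hR⟩ := exists_faceThetaDatum_of_items hH hcup2 hHR h F hG h6 f
  exact ⟨ι₁, V, ι₁, hR⟩

end Transposition

namespace Model

/-- **On the universe of record: free face theta SUPPLY data with the items' side fields give `HC_CM`** — the free items' conjunction
(`Transposition.exists_faceThetaDatum_free_of_items`) with Hodge–Riemann (2,0) = `universeOf_hodgeRiemann_pms` and the Hodge-type facts
= `universeOf_fact_pull_hodge` / `universeOf_fact_cup2_hodge` (tree theorems), then `hc_cm_closed_of_exists_faceThetaDatum_free`.
Stated over an arbitrary instance `hHD hI h₁ h₃` to keep the hypothesis readable; ONE binder; `HC_CM` is NOT proved. [folklore] -/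
theorem hc_cm_of_items_free (hHD : exists_isReal_hodgeModel) (hI : hodgePQ_independent_of_hodgeModel)
    (h₁ : BallQuotientUniformised) (h₃ : CMAbelianVarietyRealised) (hR : DeligneMilne1982_Thm_6_20_full)
    (h : ∀ (F : CMField), IsGalois ℚ F → 6 ≤ Module.finrank ℚ F → ∀ f : Face F,
      ∃ (ι₁ : F →+* ℂ) (V : HermSpace3 F ι₁) (σ : F →+* ℂ)
        (S : Transposition.FaceThetaSupply (picardCMUniverse hHD hI h₁ h₃) ι₁ V F f.psi σ)
        (HG : Type) (_ : NormedAddCommGroup HG) (_ : InnerProductSpace ℂ HG)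
        (emb : ∀ Γ : Level V, (picardCMUniverse hHD hI h₁ h₃).CohC ((picardCMUniverse hHD hI h₁ h₃).pms F ι₁ V Γ) 2 →ₗ[ℂ] HG)
        (cover : ∀ (Γ Γ' : Level V), Γ' ≤ Γ →
          (picardCMUniverse hHD hI h₁ h₃).Mor ((picardCMUniverse hHD hI h₁ h₃).pms F ι₁ V Γ')
            ((picardCMUniverse hHD hI h₁ h₃).pms F ι₁ V Γ)),
        S.Wedge ∧
        (∀ (Γ : Level V) (ω₁ ω₂ : (picardCMUniverse hHD hI h₁ h₃).CohC ((picardCMUniverse hHD hI h₁ h₃).pms F ι₁ V Γ) 1),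
          ω₁ ∈ S.Theta 0 Γ → ω₂ ∈ S.Theta 1 Γ →
          emb Γ ((picardCMUniverse hHD hI h₁ h₃).cup2C ((picardCMUniverse hHD hI h₁ h₃).pms F ι₁ V Γ) 1 ω₁ ω₂) ∈
            (Submodule.span ℂ
              {x : HG | ∃ (Γ' : Level V), ∃ ω₃ ∈ S.Theta 2 Γ', ∃ ω₄ ∈ S.Theta 3 Γ',
                x = emb Γ' ((picardCMUniverse hHD hI h₁ h₃).cup2C
                  ((picardCMUniverse hHD hI h₁ h₃).pms F ι₁ V Γ') 1 ω₃ ω₄)}).topologicalClosure) ∧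
        (∀ (Γ Γ' : Level V) (hle : Γ' ≤ Γ) (x : (picardCMUniverse hHD hI h₁ h₃).CohC
            ((picardCMUniverse hHD hI h₁ h₃).pms F ι₁ V Γ) 2),
          emb Γ' ((picardCMUniverse hHD hI h₁ h₃).pullC (cover Γ Γ' hle) 2 x) = emb Γ x) ∧
        (∀ Γ : Level V, ∃ c : ℂ, c ≠ 0 ∧
          ∀ x y : (picardCMUniverse hHD hI h₁ h₃).CohC ((picardCMUniverse hHD hI h₁ h₃).pms F ι₁ V Γ) 2,
          x ∈ ((picardCMUniverse hHD hI h₁ h₃).hodge ((picardCMUniverse hHD hI h₁ h₃).pms F ι₁ V Γ) 2).F 2 →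
          y ∈ ((picardCMUniverse hHD hI h₁ h₃).hodge ((picardCMUniverse hHD hI h₁ h₃).pms F ι₁ V Γ) 2).F 2 →
            ⟪emb Γ y, emb Γ x⟫_ℂ = c * (picardCMUniverse hHD hI h₁ h₃).trC ((picardCMUniverse hHD hI h₁ h₃).pms F ι₁ V Γ) 4
              ((picardCMUniverse hHD hI h₁ h₃).cup2C ((picardCMUniverse hHD hI h₁ h₃).pms F ι₁ V Γ) 2 x (conj y)))) :
    HC_CM :=
  hc_cm_of_exists_facePeriod_free hHD hI h₁ h₃
    (Universe.exists_periodNV_free_of_exists_faceThetaDatum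
      (universeOf_fact_pull_comp hHD hI (ballQuotientUniformisedDatum_of h₁) h₃)
      (universeOf_fact_pull_hodge hHD hI (ballQuotientUniformisedDatum_of h₁) h₃)
      (universeOf_fact_cup2_hodge hHD hI (ballQuotientUniformisedDatum_of h₁) h₃)
      (universeOf_fact_pull_cup hHD hI (ballQuotientUniformisedDatum_of h₁) h₃)
      (Transposition.exists_faceThetaDatum_free_of_items
        (universeOf_fact_pull_hodge hHD hI (ballQuotientUniformisedDatum_of h₁) h₃)
        (universeOf_fact_cup2_hodge hHD hI (ballQuotientUniformisedDatum_of h₁) h₃)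
        (fun Γ η hη h0 => universeOf_hodgeRiemann_pms hHD hI (ballQuotientUniformisedDatum_of h₁) h₃ _ Γ η hη h0) h))
    hR

end Model

end Summit.HodgeConjecture.CorCM

end
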